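import Summits.ABC.IUTFork.Cor312ColumnTransport
import Summits.ABC.IUTFork.Cor312QTwist
import Summits.ABC.IUTFork.Cor312LogKummerGlobal
import HarnessLib

/-!
# The log-Kummer route input is orbit-canonical (row C-14a)

GAP-LEDGER row G-c312-11-1 pre-registers the log-Kummer route-input family — `Cor312Vol.VolumeTransport` /
`VolumeTransportAt` ([IUTchIII] Cor. 3.12, Step (xi-g) p. 184 l. 30–34, volume-level `≤`-form) and the
print-level global forms `GlobalVolumeTransport` / `GlobalVolumeTransportAt` — as Team B's residual input:
the one hypothesis of the route `statement_of_volumeTransport` / `GlobalVolumeTransport.statement_of` not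
discharged by instance data.  Rows C-8/C-9/C-10 (`Cor312SoundInputTwist` / `…Reindex` / `…PilotTwist`)
proved the PRIMARY gap row G-c312-9-1 (`SoundAtInput`) invariant under every re-choice the frozen types
leave open.  This file does the same for the B row, so that NEITHER pre-registered gap statement depends
on unforced choices: for each of the four transports of the C census —

* **Θ-glue (Ind1)(Ind2) twist** `Setting.twistGlue` (row C-1): the family is invariant **modulo exactly
  the Step (x) volume cost** — the minimal per-object form `hvolθ` (log-volumes of the twisted Kummer
  images), discharged along the whole indeterminacy group by the landed closure engine
  (`MRData.adm_and_logvol_eq_of_mem_closure`) from generator-level admissibility transport +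
  `MRData.LogvolInvariant` + `ThetaRegionsAdm` — the exact hypotheses Team B's rows B-2/B-3 discharge at
  the real instances (p411395/p413177).
* **(Ind3) m-reindex** `Setting.reindexGlue` (rows C-1/C-9): the `∃ m` forms are invariant with **no
  hypothesis** (the lattice-position quantifier absorbs the relabelling); the fixed-position forms are
  covariant, `m₀ ↦ e m₀`, by `Iff.rfl`.
* **étale-picture column transport** `Setting.recolumn` (row C-3): invariant with **no volume
  hypothesis** — the transport `MRData.map` carries the log-volumes definitionally (helper
  `recolumn_logvol_thetaRegion`, the Θ-side sibling of the landed `recolumn_qLocal`).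
* **q-glue twist** `Setting.qTwistGlue` (row C-7): invariant modulo the per-packet q-volume equality,
  with the `_of_invariance` composites discharging it from the same generator data
  (`logvol_image_qRegion_eq_of_invariance`).

Everything is stated over the FROZEN `Cor312.Setting` (c312-7, p405425); the subjects are consumed
read-only by name from p411119 (`Cor312LogKummerRoute`) and p414039 (`Cor312LogKummerGlobal`).  §0 is a
congruence toolkit in the style of row C-1's `*_congr` lemmas, reusable by any consumer comparing two
settings packet-by-packet.  ORTHOGONALITY NOTE (B1's ask, 04:55Z): this census moves each member of the
family to ITSELF under a transport; it does not compare the members with each other — the per-packet vs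
global QUANTIFIER HIERARCHY is strict and separately certified by w5-d087's witnesses
(`Cor312QFrobNotNecessary` p413378, `Cor312VolumeTransportHierarchy` p413793); canonicity here and
non-equivalence there are one graph, different edges.  Nothing here asserts Cor. 3.12, nor that the route input HOLDS anywhere —
only that the pre-registered statement is canonical modulo the declared indeterminacy orbit and the
column.  [claim: Mochizuki2012, status: disputed] for the quoted clauses; bookkeeping proofs are
[folklore].  The lattice-level (holomorphic-reading) forms `QFrobComparison` / `QFrobEqualityAt` are row
C-14b (`Cor312QFrobTwist`), where the transports meet the reading labels.
-/

noncomputable section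

namespace Summit.ABC

namespace IUTFork

namespace Cor312Vol

open Thm311 Cor312 Literature.IUT.LogThetaLattice

variable {T : ThetaIndex} {S : Situation T}

/-! ## 0. Congruence toolkit: the route input only reads per-packet volumes -/

/-- **Congruence for the fixed-position route input**: two settings over the same situation whose q-pilot
log-volumes and per-image Θ log-volumes agree packet-by-packet have the same `VolumeTransportAt`.
[folklore] -/
theorem volumeTransportAt_congr {P₁ P₂ : Cor312.Setting S}
    (hql : ∀ (i : Fin T.lstar) (vQ : T.VQ),
      P₁.qLocal (Setting.labelSucc i) vQ = P₂.qLocal (Setting.labelSucc i) vQ)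
    (hθ : ∀ (m : ℤ) (i : Fin T.lstar) (vQ : T.VQ),
      (S.D P₁.n).logvol (Setting.labelSucc i) vQ (P₁.thetaRegion m (Setting.labelSucc i) vQ) =
        (S.D P₂.n).logvol (Setting.labelSucc i) vQ (P₂.thetaRegion m (Setting.labelSucc i) vQ))
    (m : ℤ) : VolumeTransportAt P₁ m ↔ VolumeTransportAt P₂ m := by
  unfold VolumeTransportAt
  constructor <;> intro h i vQ
  · rw [← hql i vQ, ← hθ m i vQ]
    exact h i vQ
  · rw [hql i vQ, hθ m i vQ]
    exact h i vQ

/-- **Congruence for the pointwise route input** (same hypotheses, `∃ m` form). [folklore] -/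
theorem volumeTransport_congr {P₁ P₂ : Cor312.Setting S}
    (hql : ∀ (i : Fin T.lstar) (vQ : T.VQ),
      P₁.qLocal (Setting.labelSucc i) vQ = P₂.qLocal (Setting.labelSucc i) vQ)
    (hθ : ∀ (m : ℤ) (i : Fin T.lstar) (vQ : T.VQ),
      (S.D P₁.n).logvol (Setting.labelSucc i) vQ (P₁.thetaRegion m (Setting.labelSucc i) vQ) =
        (S.D P₂.n).logvol (Setting.labelSucc i) vQ (P₂.thetaRegion m (Setting.labelSucc i) vQ)) :
    VolumeTransport P₁ ↔ VolumeTransport P₂ := by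
  unfold VolumeTransport
  constructor <;> intro h i vQ
  · obtain ⟨m, hm⟩ := h i vQ
    rw [hql i vQ, hθ m i vQ] at hm
    exact ⟨m, hm⟩
  · obtain ⟨m, hm⟩ := h i vQ
    rw [← hql i vQ, ← hθ m i vQ] at hm
    exact ⟨m, hm⟩

/-- **Congruence for the uniform global route input**: equal `−|log(q)|` and packet-wise equal per-image
Θ log-volumes give the same `GlobalVolumeTransportAt`. [folklore] -/
theorem globalVolumeTransportAt_congr {P₁ P₂ : Cor312.Setting S}
    (hnq : P₁.negLogQ = P₂.negLogQ)
    (hθ : ∀ (m : ℤ) (i : Fin T.lstar) (vQ : T.VQ),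
      (S.D P₁.n).logvol (Setting.labelSucc i) vQ (P₁.thetaRegion m (Setting.labelSucc i) vQ) =
        (S.D P₂.n).logvol (Setting.labelSucc i) vQ (P₂.thetaRegion m (Setting.labelSucc i) vQ))
    (m₀ : ℤ) : GlobalVolumeTransportAt P₁ m₀ ↔ GlobalVolumeTransportAt P₂ m₀ := by
  unfold GlobalVolumeTransportAt
  rw [hnq]
  refine and_congr (forall_congr' fun i => ?_) ?_
  · rw [show (fun vQ => (S.D P₁.n).logvol (Setting.labelSucc i) vQ
        (P₁.thetaRegion m₀ (Setting.labelSucc i) vQ)) =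
        fun vQ => (S.D P₂.n).logvol (Setting.labelSucc i) vQ
        (P₂.thetaRegion m₀ (Setting.labelSucc i) vQ)
      from funext fun vQ => hθ m₀ i vQ]
  · rw [show (fun i : Fin T.lstar => ∑ᶠ vQ : T.VQ, (S.D P₁.n).logvol (Setting.labelSucc i) vQ
        (P₁.thetaRegion m₀ (Setting.labelSucc i) vQ)) =
        fun i : Fin T.lstar => ∑ᶠ vQ : T.VQ, (S.D P₂.n).logvol (Setting.labelSucc i) vQ
        (P₂.thetaRegion m₀ (Setting.labelSucc i) vQ)
      from funext fun i => finsum_congr fun vQ => hθ m₀ i vQ]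

/-- **Congruence for the global route input** (position-assignment form). [folklore] -/
theorem globalVolumeTransport_congr {P₁ P₂ : Cor312.Setting S}
    (hnq : P₁.negLogQ = P₂.negLogQ)
    (hθ : ∀ (m : ℤ) (i : Fin T.lstar) (vQ : T.VQ),
      (S.D P₁.n).logvol (Setting.labelSucc i) vQ (P₁.thetaRegion m (Setting.labelSucc i) vQ) =
        (S.D P₂.n).logvol (Setting.labelSucc i) vQ (P₂.thetaRegion m (Setting.labelSucc i) vQ)) :
    GlobalVolumeTransport P₁ ↔ GlobalVolumeTransport P₂ := by
  unfold GlobalVolumeTransport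
  rw [hnq]
  refine exists_congr fun m => and_congr (forall_congr' fun i => ?_) ?_
  · rw [show (fun vQ => (S.D P₁.n).logvol (Setting.labelSucc i) vQ
        (P₁.thetaRegion (m i vQ) (Setting.labelSucc i) vQ)) =
        fun vQ => (S.D P₂.n).logvol (Setting.labelSucc i) vQ
        (P₂.thetaRegion (m i vQ) (Setting.labelSucc i) vQ)
      from funext fun vQ => hθ (m i vQ) i vQ]
  · rw [show (fun i : Fin T.lstar => ∑ᶠ vQ : T.VQ, (S.D P₁.n).logvol (Setting.labelSucc i) vQ
        (P₁.thetaRegion (m i vQ) (Setting.labelSucc i) vQ)) =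
        fun i : Fin T.lstar => ∑ᶠ vQ : T.VQ, (S.D P₂.n).logvol (Setting.labelSucc i) vQ
        (P₂.thetaRegion (m i vQ) (Setting.labelSucc i) vQ)
      from funext fun i => finsum_congr fun vQ => hθ (m i vQ) i vQ]

/-! ## 1. The Θ-glue (Ind1)(Ind2) twist (row C-1): invariance modulo exactly the Step (x) volume cost -/

section TwistGlue

variable (P : Cor312.Setting S) (Φ₀ : S.L.PacketAut)

/-- The honest per-object cost of the Θ-glue twist for the route input: the log-volumes of the twisted
Kummer images.  Discharged along the whole indeterminacy group by
`logvol_image_thetaRegion_eq_of_invariance` below. [claim: Mochizuki2012, status: disputed] -/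
theorem twistGlue_volumeTransportAt_iff
    (hvolθ : ∀ (m : ℤ) (i : Fin T.lstar) (vQ : T.VQ),
      (S.D P.n).logvol (Setting.labelSucc i) vQ
        (Φ₀ (Setting.labelSucc i) vQ '' P.thetaRegion m (Setting.labelSucc i) vQ) =
        (S.D P.n).logvol (Setting.labelSucc i) vQ (P.thetaRegion m (Setting.labelSucc i) vQ))
    (m : ℤ) : VolumeTransportAt (P.twistGlue Φ₀) m ↔ VolumeTransportAt P m :=
  volumeTransportAt_congr (P₁ := P.twistGlue Φ₀) (P₂ := P)
    (fun _ _ => rfl) (fun mm i vQ => hvolθ mm i vQ) m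

/-- `VolumeTransport` under the Θ-glue twist, modulo the same per-object volume cost. [claim:
Mochizuki2012, status: disputed] -/
theorem twistGlue_volumeTransport_iff
    (hvolθ : ∀ (m : ℤ) (i : Fin T.lstar) (vQ : T.VQ),
      (S.D P.n).logvol (Setting.labelSucc i) vQ
        (Φ₀ (Setting.labelSucc i) vQ '' P.thetaRegion m (Setting.labelSucc i) vQ) =
        (S.D P.n).logvol (Setting.labelSucc i) vQ (P.thetaRegion m (Setting.labelSucc i) vQ)) :
    VolumeTransport (P.twistGlue Φ₀) ↔ VolumeTransport P :=
  volumeTransport_congr (P₁ := P.twistGlue Φ₀) (P₂ := P)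
    (fun _ _ => rfl) (fun mm i vQ => hvolθ mm i vQ)

/-- `GlobalVolumeTransportAt` under the Θ-glue twist (the q-side is exempt from the indeterminacies,
`twistGlue_negLogQ`). [claim: Mochizuki2012, status: disputed] -/
theorem twistGlue_globalVolumeTransportAt_iff
    (hvolθ : ∀ (m : ℤ) (i : Fin T.lstar) (vQ : T.VQ),
      (S.D P.n).logvol (Setting.labelSucc i) vQ
        (Φ₀ (Setting.labelSucc i) vQ '' P.thetaRegion m (Setting.labelSucc i) vQ) =
        (S.D P.n).logvol (Setting.labelSucc i) vQ (P.thetaRegion m (Setting.labelSucc i) vQ))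
    (m₀ : ℤ) : GlobalVolumeTransportAt (P.twistGlue Φ₀) m₀ ↔ GlobalVolumeTransportAt P m₀ :=
  globalVolumeTransportAt_congr (P.twistGlue_negLogQ Φ₀) (fun mm i vQ => hvolθ mm i vQ) m₀

/-- `GlobalVolumeTransport` under the Θ-glue twist. [claim: Mochizuki2012, status: disputed] -/
theorem twistGlue_globalVolumeTransport_iff
    (hvolθ : ∀ (m : ℤ) (i : Fin T.lstar) (vQ : T.VQ),
      (S.D P.n).logvol (Setting.labelSucc i) vQ
        (Φ₀ (Setting.labelSucc i) vQ '' P.thetaRegion m (Setting.labelSucc i) vQ) =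
        (S.D P.n).logvol (Setting.labelSucc i) vQ (P.thetaRegion m (Setting.labelSucc i) vQ)) :
    GlobalVolumeTransport (P.twistGlue Φ₀) ↔ GlobalVolumeTransport P :=
  globalVolumeTransport_congr (P.twistGlue_negLogQ Φ₀) (fun mm i vQ => hvolθ mm i vQ)

/-- **Discharge of the per-object cost along the WHOLE indeterminacy group**: generator-level
admissibility transport + `MRData.LogvolInvariant` (Step (x), Team B row B-2) + `ThetaRegionsAdm` (row
B-3) give the twisted-image volume equality for every `Φ₀ ∈ indGroup S` — via the landed closure engine
`MRData.adm_and_logvol_eq_of_mem_closure` (L6-t13). [folklore] -/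
theorem logvol_image_thetaRegion_eq_of_invariance
    (hAdm : ∀ Φ ∈ S.L.Ind1Family ∪ S.L.Ind2Family, ∀ (j : T.Label) (vQ : T.VQ)
      (A : Set (S.L.Packet j vQ)), (S.D P.n).Adm j vQ A ↔ (S.D P.n).Adm j vQ (Φ j vQ '' A))
    (hvol : (S.D P.n).LogvolInvariant) (hΦ₀ : Φ₀ ∈ Setting.indGroup S)
    (hadm : ThetaRegionsAdm P) (m : ℤ) (i : Fin T.lstar) (vQ : T.VQ) :
    (S.D P.n).logvol (Setting.labelSucc i) vQ
      (Φ₀ (Setting.labelSucc i) vQ '' P.thetaRegion m (Setting.labelSucc i) vQ) =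
      (S.D P.n).logvol (Setting.labelSucc i) vQ (P.thetaRegion m (Setting.labelSucc i) vQ) :=
  ((S.D P.n).adm_and_logvol_eq_of_mem_closure hAdm hvol hΦ₀ _ _ _ (hadm m i vQ)).2

/-- **Θ-GLUE CANONICITY OF THE ROUTE INPUT**: under the discharged Step (x) invariance, re-choosing the
Θ-side Kummer identification within its (Ind1)(Ind2) orbit does not move `VolumeTransport`. [claim:
Mochizuki2012, status: disputed] -/
theorem twistGlue_volumeTransport_iff_of_invariance
    (hAdm : ∀ Φ ∈ S.L.Ind1Family ∪ S.L.Ind2Family, ∀ (j : T.Label) (vQ : T.VQ)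
      (A : Set (S.L.Packet j vQ)), (S.D P.n).Adm j vQ A ↔ (S.D P.n).Adm j vQ (Φ j vQ '' A))
    (hvol : (S.D P.n).LogvolInvariant) (hΦ₀ : Φ₀ ∈ Setting.indGroup S) (hadm : ThetaRegionsAdm P) :
    VolumeTransport (P.twistGlue Φ₀) ↔ VolumeTransport P :=
  twistGlue_volumeTransport_iff P Φ₀
    (logvol_image_thetaRegion_eq_of_invariance P Φ₀ hAdm hvol hΦ₀ hadm)

/-- Θ-glue canonicity of the PRINT-LEVEL global route input, same discharge. [claim: Mochizuki2012,
status: disputed] -/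
theorem twistGlue_globalVolumeTransport_iff_of_invariance
    (hAdm : ∀ Φ ∈ S.L.Ind1Family ∪ S.L.Ind2Family, ∀ (j : T.Label) (vQ : T.VQ)
      (A : Set (S.L.Packet j vQ)), (S.D P.n).Adm j vQ A ↔ (S.D P.n).Adm j vQ (Φ j vQ '' A))
    (hvol : (S.D P.n).LogvolInvariant) (hΦ₀ : Φ₀ ∈ Setting.indGroup S) (hadm : ThetaRegionsAdm P) :
    GlobalVolumeTransport (P.twistGlue Φ₀) ↔ GlobalVolumeTransport P :=
  twistGlue_globalVolumeTransport_iff P Φ₀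
    (logvol_image_thetaRegion_eq_of_invariance P Φ₀ hAdm hvol hΦ₀ hadm)

end TwistGlue

/-! ## 2. The (Ind3) m-reindex (rows C-1/C-9): absorbed with NO hypothesis -/

section ReindexGlue

variable (P : Cor312.Setting S) (e : ℤ ≃ ℤ)

/-- The fixed-position form is COVARIANT under the (Ind3) relabelling — definitionally: position `m` of
the reindexed glue reads position `e m` of the original. [folklore] -/
theorem reindexGlue_volumeTransportAt (m : ℤ) :
    VolumeTransportAt (P.reindexGlue e) m ↔ VolumeTransportAt P (e m) :=
  Iff.rfl

/-- **(Ind3) ABSORPTION for the route input**: the `∃ m` quantifier absorbs any re-indexing of the Kummer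
tower — no hypothesis. [folklore] -/
theorem reindexGlue_volumeTransport_iff :
    VolumeTransport (P.reindexGlue e) ↔ VolumeTransport P := by
  unfold VolumeTransport
  constructor <;> intro h i vQ
  · obtain ⟨m, hm⟩ := h i vQ
    exact ⟨e m, hm⟩
  · obtain ⟨m, hm⟩ := h i vQ
    refine ⟨e.symm m, ?_⟩
    show P.qLocal (Setting.labelSucc i) vQ ≤ (S.D P.n).logvol (Setting.labelSucc i) vQ
      (P.thetaRegion (e (e.symm m)) (Setting.labelSucc i) vQ)
    rw [Equiv.apply_symm_apply]
    exact hm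

/-- The uniform global form is COVARIANT under the (Ind3) relabelling, definitionally. [folklore] -/
theorem reindexGlue_globalVolumeTransportAt (m₀ : ℤ) :
    GlobalVolumeTransportAt (P.reindexGlue e) m₀ ↔ GlobalVolumeTransportAt P (e m₀) :=
  Iff.rfl

/-- **(Ind3) ABSORPTION for the global route input**: the position-assignment quantifier absorbs the
relabelling — no hypothesis. [folklore] -/
theorem reindexGlue_globalVolumeTransport_iff :
    GlobalVolumeTransport (P.reindexGlue e) ↔ GlobalVolumeTransport P := by
  unfold GlobalVolumeTransport
  constructor
  · rintro ⟨m, hfin, hle⟩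
    exact ⟨fun i vQ => e (m i vQ), hfin, hle⟩
  · rintro ⟨m, hfin, hle⟩
    refine ⟨fun i vQ => e.symm (m i vQ), fun i => ?_, ?_⟩
    · show (Function.support fun vQ => (S.D P.n).logvol (Setting.labelSucc i) vQ
        (P.thetaRegion (e (e.symm (m i vQ))) (Setting.labelSucc i) vQ)).Finite
      simp only [Equiv.apply_symm_apply]
      exact hfin i
    · show P.negLogQ ≤ processionNormalized fun i : Fin T.lstar =>
        ∑ᶠ vQ : T.VQ, (S.D P.n).logvol (Setting.labelSucc i) vQ
          (P.thetaRegion (e (e.symm (m i vQ))) (Setting.labelSucc i) vQ)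
      simp only [Equiv.apply_symm_apply]
      exact hle

end ReindexGlue

/-! ## 3. The étale-picture column transport (row C-3): invariance with NO volume hypothesis -/

section Recolumn

variable (P : Cor312.Setting S) (n' : ℤ) (Φ : S.L.PacketAut) (hD : S.D n' = (S.D P.n).map Φ)

/-- The transported per-image Θ log-volumes agree with the originals — definitionally through
`MRData.map` (the Θ-side sibling of the landed `recolumn_qLocal`; no invariance hypothesis). [folklore] -/
theorem recolumn_logvol_thetaRegion (m : ℤ) (j : T.Label) (vQ : T.VQ) :
    (S.D (P.recolumn n' Φ hD).n).logvol j vQ ((P.recolumn n' Φ hD).thetaRegion m j vQ) =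
      (S.D P.n).logvol j vQ (P.thetaRegion m j vQ) := by
  rw [P.recolumn_n n' Φ hD, hD]
  show (S.D P.n).logvol j vQ
    (⇑((Φ j vQ).symm) '' (⇑(Φ j vQ) '' P.thetaRegion m j vQ)) = _
  rw [Setting.image_symm_image]

/-- `VolumeTransportAt` is COLUMN-INDEPENDENT along the étale-picture transport — no hypothesis beyond
the transport data. [claim: Mochizuki2012, status: disputed] -/
theorem recolumn_volumeTransportAt_iff (m : ℤ) :
    VolumeTransportAt (P.recolumn n' Φ hD) m ↔ VolumeTransportAt P m :=
  volumeTransportAt_congr (fun i vQ => P.recolumn_qLocal n' Φ hD (Setting.labelSucc i) vQ)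
    (fun mm i vQ => recolumn_logvol_thetaRegion P n' Φ hD mm (Setting.labelSucc i) vQ) m

/-- `VolumeTransport` is COLUMN-INDEPENDENT along the étale-picture transport. [claim: Mochizuki2012,
status: disputed] -/
theorem recolumn_volumeTransport_iff :
    VolumeTransport (P.recolumn n' Φ hD) ↔ VolumeTransport P :=
  volumeTransport_congr (fun i vQ => P.recolumn_qLocal n' Φ hD (Setting.labelSucc i) vQ)
    (fun mm i vQ => recolumn_logvol_thetaRegion P n' Φ hD mm (Setting.labelSucc i) vQ)

/-- `GlobalVolumeTransportAt` is COLUMN-INDEPENDENT along the étale-picture transport. [claim: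
Mochizuki2012, status: disputed] -/
theorem recolumn_globalVolumeTransportAt_iff (m₀ : ℤ) :
    GlobalVolumeTransportAt (P.recolumn n' Φ hD) m₀ ↔ GlobalVolumeTransportAt P m₀ :=
  globalVolumeTransportAt_congr (P.recolumn_negLogQ n' Φ hD)
    (fun mm i vQ => recolumn_logvol_thetaRegion P n' Φ hD mm (Setting.labelSucc i) vQ) m₀

/-- **COLUMN INDEPENDENCE OF THE GLOBAL ROUTE INPUT**: the print-level (G1′) gap statement does not
depend on the column — definitional volume transport, no invariance hypothesis. [claim: Mochizuki2012,
status: disputed] -/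
theorem recolumn_globalVolumeTransport_iff :
    GlobalVolumeTransport (P.recolumn n' Φ hD) ↔ GlobalVolumeTransport P :=
  globalVolumeTransport_congr (P.recolumn_negLogQ n' Φ hD)
    (fun mm i vQ => recolumn_logvol_thetaRegion P n' Φ hD mm (Setting.labelSucc i) vQ)

end Recolumn

/-! ## 4. The q-glue twist (row C-7): invariance modulo the per-packet q-volume equality -/

section QTwistGlue

variable (P : Cor312.Setting S) (Φ₀ : S.L.PacketAut)
  (hmem : ∀ (j : T.Label) (vQ : T.VQ),
    Φ₀ j vQ '' P.qRegionOf (qPilotObject P.qData) j vQ ∈ (P.frame j vQ).Hul)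
  (hfin : ∀ j : T.Label, (Function.support fun vQ =>
    (S.D P.n).logvol j vQ (Φ₀ j vQ '' P.qRegionOf (qPilotObject P.qData) j vQ)).Finite)

/-- `VolumeTransportAt` under the q-glue twist, modulo the per-packet q-volume equality (the Θ-side never
reads the q-glue). [claim: Mochizuki2012, status: disputed] -/
theorem qTwistGlue_volumeTransportAt_iff_of_logvol
    (hvolq : ∀ (j : T.Label) (vQ : T.VQ),
      (S.D P.n).logvol j vQ (Φ₀ j vQ '' P.qRegion j vQ) = (S.D P.n).logvol j vQ (P.qRegion j vQ))
    (m : ℤ) : VolumeTransportAt (P.qTwistGlue Φ₀ hmem hfin) m ↔ VolumeTransportAt P m :=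
  volumeTransportAt_congr (P₁ := P.qTwistGlue Φ₀ hmem hfin) (P₂ := P)
    (fun i vQ => hvolq (Setting.labelSucc i) vQ) (fun _ _ _ => rfl) m

/-- `VolumeTransport` under the q-glue twist, same cost. [claim: Mochizuki2012, status: disputed] -/
theorem qTwistGlue_volumeTransport_iff_of_logvol
    (hvolq : ∀ (j : T.Label) (vQ : T.VQ),
      (S.D P.n).logvol j vQ (Φ₀ j vQ '' P.qRegion j vQ) = (S.D P.n).logvol j vQ (P.qRegion j vQ)) :
    VolumeTransport (P.qTwistGlue Φ₀ hmem hfin) ↔ VolumeTransport P :=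
  volumeTransport_congr (P₁ := P.qTwistGlue Φ₀ hmem hfin) (P₂ := P)
    (fun i vQ => hvolq (Setting.labelSucc i) vQ) (fun _ _ _ => rfl)

/-- `GlobalVolumeTransportAt` under the q-glue twist (the q-side enters only through `−|log(q)|`,
`qTwistGlue_negLogQ_of_logvol`). [claim: Mochizuki2012, status: disputed] -/
theorem qTwistGlue_globalVolumeTransportAt_iff_of_logvol
    (hvolq : ∀ (j : T.Label) (vQ : T.VQ),
      (S.D P.n).logvol j vQ (Φ₀ j vQ '' P.qRegion j vQ) = (S.D P.n).logvol j vQ (P.qRegion j vQ))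
    (m₀ : ℤ) :
    GlobalVolumeTransportAt (P.qTwistGlue Φ₀ hmem hfin) m₀ ↔ GlobalVolumeTransportAt P m₀ :=
  globalVolumeTransportAt_congr (P.qTwistGlue_negLogQ_of_logvol Φ₀ hmem hfin hvolq)
    (fun _ _ _ => rfl) m₀

/-- `GlobalVolumeTransport` under the q-glue twist. [claim: Mochizuki2012, status: disputed] -/
theorem qTwistGlue_globalVolumeTransport_iff_of_logvol
    (hvolq : ∀ (j : T.Label) (vQ : T.VQ),
      (S.D P.n).logvol j vQ (Φ₀ j vQ '' P.qRegion j vQ) = (S.D P.n).logvol j vQ (P.qRegion j vQ)) :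
    GlobalVolumeTransport (P.qTwistGlue Φ₀ hmem hfin) ↔ GlobalVolumeTransport P :=
  globalVolumeTransport_congr (P.qTwistGlue_negLogQ_of_logvol Φ₀ hmem hfin hvolq)
    (fun _ _ _ => rfl)

/-- **Q-GLUE CANONICITY OF THE ROUTE INPUT**: under the discharged Step (x) generator invariance the
per-packet q-volume cost vanishes (`logvol_image_qRegion_eq_of_invariance`, row C-7), so the route input
is q-twist-canonical on all of `indGroup S`. [claim: Mochizuki2012, status: disputed] -/
theorem qTwistGlue_volumeTransport_iff_of_invariance
    (hAdm : ∀ Φ ∈ S.L.Ind1Family ∪ S.L.Ind2Family, ∀ (j : T.Label) (vQ : T.VQ)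
      (A : Set (S.L.Packet j vQ)), (S.D P.n).Adm j vQ A ↔ (S.D P.n).Adm j vQ (Φ j vQ '' A))
    (hvol : (S.D P.n).LogvolInvariant) (hΦ₀ : Φ₀ ∈ Setting.indGroup S) :
    VolumeTransport (P.qTwistGlue Φ₀ hmem hfin) ↔ VolumeTransport P :=
  qTwistGlue_volumeTransport_iff_of_logvol P Φ₀ hmem hfin
    (fun j vQ => P.logvol_image_qRegion_eq_of_invariance Φ₀ hAdm hvol hΦ₀ j vQ)

/-- Q-glue canonicity of the PRINT-LEVEL global route input, same discharge. [claim: Mochizuki2012,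
status: disputed] -/
theorem qTwistGlue_globalVolumeTransport_iff_of_invariance
    (hAdm : ∀ Φ ∈ S.L.Ind1Family ∪ S.L.Ind2Family, ∀ (j : T.Label) (vQ : T.VQ)
      (A : Set (S.L.Packet j vQ)), (S.D P.n).Adm j vQ A ↔ (S.D P.n).Adm j vQ (Φ j vQ '' A))
    (hvol : (S.D P.n).LogvolInvariant) (hΦ₀ : Φ₀ ∈ Setting.indGroup S) :
    GlobalVolumeTransport (P.qTwistGlue Φ₀ hmem hfin) ↔ GlobalVolumeTransport P :=
  qTwistGlue_globalVolumeTransport_iff_of_logvol P Φ₀ hmem hfin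
    (fun j vQ => P.logvol_image_qRegion_eq_of_invariance Φ₀ hAdm hvol hΦ₀ j vQ)

end QTwistGlue

end Cor312Vol

end IUTFork

end Summit.ABC
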